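import Summits.CriticalPhenomena.SAWScalingLimit.Theses.SAWDevelopingMap
import Summits.CriticalPhenomena.SAWScalingLimit.Theorems.SAWDevelopingMapPotentialExistsPoincare
import Literature.Probability.RandomPlanarGeometry.HexParafermionProofs
import HarnessLib

/-!
# Route `SAWDevelopingMap`, item `PotentialExists` (stmt-CriticalPhenomena-8299): `F = dH`

Closing file (4/4) for the support item `PotentialExists` of the route `SAWDevelopingMap`
(`Summits/CriticalPhenomena/SAWScalingLimit/Theses/SAWDevelopingMap.lean`):
**`potentialExists_proof : PotentialExists`** — for every simply connected hexagonal domain `Λ`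
and boundary mid-edge `a` there is `H : Site 2 → ℂ` on the hexagon centres (vertices of `𝕋`)
such that for every `v ∈ Λ`, every neighbour `w` and the common `𝕋`-edge `{s, t}` of the two
triangles, oriented with the centre of `v` on its left,
`H t - H s = (hexMidpoint {v, w} - hexCenter v) · F({v, w})`, `F` the parafermionic observable
at `x = x_c`, `σ = 5/8` (Duminil-Copin–Smirnov 2012, the potential behind Lemma 1).

Proof.  The dart function `g v w := (hexMidpoint {v, w} - hexCenter v) · F({v, w})` is
antisymmetric (the mid-edge is the mean of the two centres) and closed on every face of `Λ` —
this is exactly DCS Lemma 1, the tree theorem `DuminilCopinSmirnov2012_lemma1_holds`.  The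
discrete Poincaré lemma `PotentialExists.exists_potential`
(`SAWDevelopingMapPotentialExists{Extension,Poincare}.lean`, resting on the winding-number
obstruction of `SAWDevelopingMapPotentialExistsTopology.lean`) integrates it to a potential `H` in lattice
coordinates; `oriented_edge_cases` translates the geometric orientation predicate of the route
statement (`0 < Im (conj (t - s) · (c_v - s))`, i.e. `c_v` to the left of `s → t`) into the six
coordinate configurations (face type × edge), the reversed orientation of each edge being
excluded by the sign computation `im_conj_mul_swap`.

No new definitions; every declaration is proved; no named-fact hypotheses.
-/

noncomputable section

namespace Summit.CriticalPhenomena.SAWScalingLimit.Theorems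

open Finset Literature.Probability.LatticeModels Literature.Probability.RandomPlanarGeometry.SAW
open scoped ComplexConjugate

namespace PotentialExists

/-! ### Orientation of the edges of a face -/

/-- `triEmbed e₀ = 1`. [folklore] -/
theorem triEmbed_single_zero : triEmbed (Pi.single 0 1 : Site 2) = 1 := by simp [triEmbed]

/-- `triEmbed e₁ = ζ`. [folklore] -/
theorem triEmbed_single_one : triEmbed (Pi.single 1 1 : Site 2) = triZeta := by simp [triEmbed]

/-- Reversing an edge flips the sign of the orientation test `Im (conj (t - s) · (c - s))`
(the difference of the two is `|t - s|²`, which is real). [folklore] -/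
theorem im_conj_mul_swap (s t c : ℂ) :
    (conj (s - t) * (c - t)).im = -(conj (t - s) * (c - s)).im := by
  simp only [Complex.mul_im, Complex.sub_re, Complex.sub_im, Complex.conj_re, Complex.conj_im]
  ring

/-- If `c` lies to the left of `s → t` then it does not lie to the left of `t → s`. [folklore] -/
theorem not_oriented_swap {s t c : ℂ} (h : 0 < (conj (t - s) * (c - s)).im) :
    ¬ 0 < (conj (s - t) * (c - t)).im := by
  rw [im_conj_mul_swap]; linarith

/-- The centre of the up face `(x, 0)` lies to the left of its edge `x → x + e₀`. [folklore] -/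
theorem oriented_up_fst (x : Site 2) :
    0 < (conj (triEmbed (x + Pi.single 0 1) - triEmbed x) * (hexCenter (x, 0) - triEmbed x)).im := by
  simp only [hexCenter, triEmbed_add, triEmbed_single_zero, triZeta_eq]
  simp

/-- The centre of the up face `(x, 0)` lies to the left of its edge `x + e₀ → x + e₁`.
[folklore] -/
theorem oriented_up_snd (x : Site 2) :
    0 < (conj (triEmbed (x + Pi.single 1 1) - triEmbed (x + Pi.single 0 1)) *
      (hexCenter (x, 0) - triEmbed (x + Pi.single 0 1))).im := by
  simp only [hexCenter, triEmbed_add, triEmbed_single_zero, triEmbed_single_one, triZeta_eq]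
  simp [Complex.mul_im]
  nlinarith [Real.sqrt_pos.2 (show (0 : ℝ) < 3 by norm_num)]

/-- The centre of the up face `(x, 0)` lies to the left of its edge `x + e₁ → x`. [folklore] -/
theorem oriented_up_thd (x : Site 2) :
    0 < (conj (triEmbed x - triEmbed (x + Pi.single 1 1)) *
      (hexCenter (x, 0) - triEmbed (x + Pi.single 1 1))).im := by
  simp only [hexCenter, triEmbed_add, triEmbed_single_one, triZeta_eq]
  simp [Complex.mul_im]
  nlinarith [Real.sqrt_pos.2 (show (0 : ℝ) < 3 by norm_num)]

/-- The centre of the down face `(x, 1)` lies to the left of its edge `x + e₀ → x + e₀ + e₁`.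
[folklore] -/
theorem oriented_down_fst (x : Site 2) :
    0 < (conj (triEmbed (x + Pi.single 0 1 + Pi.single 1 1) - triEmbed (x + Pi.single 0 1)) *
      (hexCenter (x, 1) - triEmbed (x + Pi.single 0 1))).im := by
  simp only [hexCenter, triEmbed_add, triEmbed_single_zero, triEmbed_single_one, triZeta_eq]
  simp [Complex.mul_im]
  nlinarith [Real.sqrt_pos.2 (show (0 : ℝ) < 3 by norm_num)]

/-- The centre of the down face `(x, 1)` lies to the left of its edge `x + e₀ + e₁ → x + e₁`.
[folklore] -/
theorem oriented_down_snd (x : Site 2) :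
    0 < (conj (triEmbed (x + Pi.single 1 1) - triEmbed (x + Pi.single 0 1 + Pi.single 1 1)) *
      (hexCenter (x, 1) - triEmbed (x + Pi.single 0 1 + Pi.single 1 1))).im := by
  simp only [hexCenter, triEmbed_add, triEmbed_single_zero, triEmbed_single_one, triZeta_eq]
  simp [Complex.mul_im]
  nlinarith [Real.sqrt_pos.2 (show (0 : ℝ) < 3 by norm_num)]

/-- The centre of the down face `(x, 1)` lies to the left of its edge `x + e₁ → x + e₀`.
[folklore] -/
theorem oriented_down_thd (x : Site 2) :
    0 < (conj (triEmbed (x + Pi.single 0 1) - triEmbed (x + Pi.single 1 1)) *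
      (hexCenter (x, 1) - triEmbed (x + Pi.single 1 1))).im := by
  simp only [hexCenter, triEmbed_add, triEmbed_single_zero, triEmbed_single_one, triZeta_eq]
  simp [Complex.mul_im]
  nlinarith [Real.sqrt_pos.2 (show (0 : ℝ) < 3 by norm_num)]

/-! ### The shared edge of a down face with its neighbours -/

/-- The down face `(x, 1)` and the up face `(x + e₀, 0)` share exactly the vertices `x + e₀`,
`x + e₀ + e₁`. [folklore] -/
theorem mem_inter_down_right {x s : Site 2} (hs : s ∈ hexFaceVertices (x, 1))
    (hs' : s ∈ hexFaceVertices (x + Pi.single 0 1, 0)) :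
    s = x + Pi.single 0 1 ∨ s = x + Pi.single 0 1 + Pi.single 1 1 := by
  rw [mem_hexFaceVertices_one] at hs
  rw [mem_hexFaceVertices_zero] at hs'
  simp only [site_two_eq_iff, Pi.add_apply, Pi.single_apply] at hs hs' ⊢
  simp at hs hs' ⊢
  omega

/-- The down face `(x, 1)` and the up face `(x + e₁, 0)` share exactly the vertices
`x + e₀ + e₁`, `x + e₁`. [folklore] -/
theorem mem_inter_down_top {x s : Site 2} (hs : s ∈ hexFaceVertices (x, 1))
    (hs' : s ∈ hexFaceVertices (x + Pi.single 1 1, 0)) :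
    s = x + Pi.single 0 1 + Pi.single 1 1 ∨ s = x + Pi.single 1 1 := by
  rw [mem_hexFaceVertices_one] at hs
  rw [mem_hexFaceVertices_zero] at hs'
  simp only [site_two_eq_iff, Pi.add_apply, Pi.single_apply] at hs hs' ⊢
  simp at hs hs' ⊢
  omega

/-! ### Normal form of an oriented dual edge -/

/-- **The six oriented edge configurations.** If `w` is a neighbour of the face `v`, `{s, t}` is
their common `𝕋`-edge and the centre of `v` lies to the left of `s → t`
(`0 < Im (conj (t - s) · (c_v - s))`), then `(v, w, s, t)` is one of: for an up face `v = (x, 0)`,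
`((x - e₁, 1), x, x + e₀)`, `((x, 1), x + e₀, x + e₁)`, `((x - e₀, 1), x + e₁, x)`; for a down face
`v = (x, 1)`, `((x + e₀, 0), x + e₀, x + e₀ + e₁)`, `((x + e₁, 0), x + e₀ + e₁, x + e₁)`,
`((x, 0), x + e₁, x + e₀)`. [folklore] -/
theorem oriented_edge_cases {v w : HexVertex} {s t : Site 2} (hadj : hexGraph.Adj v w)
    (hs : s ∈ hexFaceVertices v) (ht : t ∈ hexFaceVertices v)
    (hs' : s ∈ hexFaceVertices w) (ht' : t ∈ hexFaceVertices w) (hst : s ≠ t)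
    (hor : 0 < (conj (triEmbed t - triEmbed s) * (hexCenter v - triEmbed s)).im) :
    ∃ x : Site 2,
      (v = (x, 0) ∧ ((w = (x - Pi.single 1 1, 1) ∧ s = x ∧ t = x + Pi.single 0 1) ∨
          (w = (x, 1) ∧ s = x + Pi.single 0 1 ∧ t = x + Pi.single 1 1) ∨
          (w = (x - Pi.single 0 1, 1) ∧ s = x + Pi.single 1 1 ∧ t = x))) ∨
      (v = (x, 1) ∧ ((w = (x + Pi.single 0 1, 0) ∧ s = x + Pi.single 0 1 ∧
            t = x + Pi.single 0 1 + Pi.single 1 1) ∨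
          (w = (x + Pi.single 1 1, 0) ∧ s = x + Pi.single 0 1 + Pi.single 1 1 ∧
            t = x + Pi.single 1 1) ∨
          (w = (x, 0) ∧ s = x + Pi.single 1 1 ∧ t = x + Pi.single 0 1))) := by
  obtain ⟨x, k⟩ := v
  obtain ⟨y, l⟩ := w
  fin_cases k <;> fin_cases l
  · exact absurd hadj (not_hexGraph_adj_of_snd_eq_holds _ _ rfl)
  · simp only [Fin.zero_eta, Fin.mk_one] at hadj hs ht hs' ht' hor ⊢
    rcases (hexGraph_adj_iff_of_snd_eq_zero_holds x y).1 hadj with rfl | rfl | rfl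
    · rcases mem_inter_up_down hs hs' with hs1 | hs1 <;>
        rcases mem_inter_up_down ht ht' with ht1 | ht1
      · exact absurd (hs1.trans ht1.symm) hst
      · exact ⟨_, Or.inl ⟨rfl, Or.inr (Or.inl ⟨rfl, hs1, ht1⟩)⟩⟩
      · rw [hs1, ht1] at hor; exact absurd hor (not_oriented_swap (oriented_up_snd _))
      · exact absurd (hs1.trans ht1.symm) hst
    · rcases mem_inter_up_left hs hs' with hs1 | hs1 <;>
        rcases mem_inter_up_left ht ht' with ht1 | ht1
      · exact absurd (hs1.trans ht1.symm) hst
      · rw [hs1, ht1] at hor; exact absurd hor (not_oriented_swap (oriented_up_thd _))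
      · exact ⟨_, Or.inl ⟨rfl, Or.inr (Or.inr ⟨rfl, hs1, ht1⟩)⟩⟩
      · exact absurd (hs1.trans ht1.symm) hst
    · rcases mem_inter_up_bottom hs hs' with hs1 | hs1 <;>
        rcases mem_inter_up_bottom ht ht' with ht1 | ht1
      · exact absurd (hs1.trans ht1.symm) hst
      · exact ⟨_, Or.inl ⟨rfl, Or.inl ⟨rfl, hs1, ht1⟩⟩⟩
      · rw [hs1, ht1] at hor; exact absurd hor (not_oriented_swap (oriented_up_fst _))
      · exact absurd (hs1.trans ht1.symm) hst
  · simp only [Fin.zero_eta, Fin.mk_one] at hadj hs ht hs' ht' hor ⊢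
    rcases (hexGraph_adj_iff_of_snd_eq_one x y).1 hadj with rfl | rfl | rfl
    · rcases mem_inter_up_down hs' hs with hs1 | hs1 <;>
        rcases mem_inter_up_down ht' ht with ht1 | ht1
      · exact absurd (hs1.trans ht1.symm) hst
      · rw [hs1, ht1] at hor; exact absurd hor (not_oriented_swap (oriented_down_thd _))
      · exact ⟨_, Or.inr ⟨rfl, Or.inr (Or.inr ⟨rfl, hs1, ht1⟩)⟩⟩
      · exact absurd (hs1.trans ht1.symm) hst
    · rcases mem_inter_down_right hs hs' with hs1 | hs1 <;>
        rcases mem_inter_down_right ht ht' with ht1 | ht1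
      · exact absurd (hs1.trans ht1.symm) hst
      · exact ⟨_, Or.inr ⟨rfl, Or.inl ⟨rfl, hs1, ht1⟩⟩⟩
      · rw [hs1, ht1] at hor; exact absurd hor (not_oriented_swap (oriented_down_fst _))
      · exact absurd (hs1.trans ht1.symm) hst
    · rcases mem_inter_down_top hs hs' with hs1 | hs1 <;>
        rcases mem_inter_down_top ht ht' with ht1 | ht1
      · exact absurd (hs1.trans ht1.symm) hst
      · exact ⟨_, Or.inr ⟨rfl, Or.inr (Or.inl ⟨rfl, hs1, ht1⟩)⟩⟩
      · rw [hs1, ht1] at hor; exact absurd hor (not_oriented_swap (oriented_down_snd _))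
      · exact absurd (hs1.trans ht1.symm) hst
  · exact absurd hadj (not_hexGraph_adj_of_snd_eq_holds _ _ rfl)

end PotentialExists

open PotentialExists in
/-- **The potential lemma `F = dH` (item `PotentialExists`, stmt-CriticalPhenomena-8299).** For
every simply connected hexagonal domain `Λ` and boundary mid-edge `a` there is
`H : Site 2 → ℂ` on the hexagon centres such that for every `v ∈ Λ`, every neighbour `w` and the
common `𝕋`-edge `{s, t} = hexFaceVertices v ∩ hexFaceVertices w`, oriented with the centre of
`v` on its left, `H t - H s = (hexMidpoint {v, w} - hexCenter v) · F({v, w})` with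
`F = hexParafermionicObservable Λ a x_c (5/8)`.  Closedness on each triangle of `Λ` is
Duminil-Copin–Smirnov's Lemma 1 (`DuminilCopinSmirnov2012_lemma1_holds`), antisymmetry across
interior edges holds because the mid-edge is the mean of the two centres, and exactness is the
discrete Poincaré lemma `PotentialExists.exists_potential` on the simply connected union of the
closed triangles of `Λ`. -/
theorem potentialExists_proof :
    Summit.CriticalPhenomena.SAWScalingLimit.Theses.SAWDevelopingMap.PotentialExists := by
  intro Λ hΛ a ha
  set F : Sym2 HexVertex → ℂ :=
    hexParafermionicObservable Λ a hexCriticalFugacity (5 / 8) with hF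
  set g : HexVertex → HexVertex → ℂ := fun v w => (hexMidpoint s(v, w) - hexCenter v) * F s(v, w)
    with hg
  -- antisymmetry: the mid-edge is the mean of the two centres
  have hanti : ∀ v ∈ Λ, ∀ w ∈ Λ, hexGraph.Adj v w → g w v = -g v w := by
    intro v _ w _ _
    simp only [hg, hexMidpoint_mk, Sym2.eq_swap (a := w)]
    ring
  -- closedness: DCS Lemma 1 at every face of `Λ`
  have hL1 := DuminilCopinSmirnov2012_lemma1_holds Λ hΛ a ha
  rw [show (Real.sqrt (2 + Real.sqrt 2))⁻¹ = hexCriticalFugacity from rfl] at hL1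
  have hcl0 : ∀ x : Site 2, (x, (0 : Fin 2)) ∈ Λ →
      g (x, 0) (x - Pi.single 1 1, 1) + g (x, 0) (x, 1) + g (x, 0) (x - Pi.single 0 1, 1) = 0 := by
    intro x hx
    have h0 : hexGraph.Adj (x, 0) (x - Pi.single 1 1, 1) :=
      (hexGraph_adj_iff_of_snd_eq_zero_holds x _).2 (Or.inr (Or.inr rfl))
    have h1 : hexGraph.Adj (x, 0) (x, 1) :=
      (hexGraph_adj_iff_of_snd_eq_zero_holds x _).2 (Or.inl rfl)
    have h2 : hexGraph.Adj (x, 0) (x - Pi.single 0 1, 1) :=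
      (hexGraph_adj_iff_of_snd_eq_zero_holds x _).2 (Or.inr (Or.inl rfl))
    have n01 : ((x - Pi.single 1 1, 1) : HexVertex) ≠ (x, 1) := by
      intro h; have := congrArg (fun f : HexVertex => f.1 1) h; simp at this
    have n12 : ((x, 1) : HexVertex) ≠ (x - Pi.single 0 1, 1) := by
      intro h; have := congrArg (fun f : HexVertex => f.1 0) h.symm; simp at this
    have n02 : ((x - Pi.single 1 1, 1) : HexVertex) ≠ (x - Pi.single 0 1, 1) := by
      intro h; have := congrArg (fun f : HexVertex => f.1 1) h; simp at this
    exact hL1 (x, 0) hx _ _ _ h0 h1 h2 n01 n12 n02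
  have hcl1 : ∀ x : Site 2, (x, (1 : Fin 2)) ∈ Λ →
      g (x, 1) (x + Pi.single 0 1, 0) + g (x, 1) (x + Pi.single 1 1, 0) + g (x, 1) (x, 0) = 0 := by
    intro x hx
    have h0 : hexGraph.Adj (x, 1) (x + Pi.single 0 1, 0) :=
      (hexGraph_adj_iff_of_snd_eq_one x _).2 (Or.inr (Or.inl rfl))
    have h1 : hexGraph.Adj (x, 1) (x + Pi.single 1 1, 0) :=
      (hexGraph_adj_iff_of_snd_eq_one x _).2 (Or.inr (Or.inr rfl))
    have h2 : hexGraph.Adj (x, 1) (x, 0) := (hexGraph_adj_iff_of_snd_eq_one x _).2 (Or.inl rfl)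
    have n01 : ((x + Pi.single 0 1, 0) : HexVertex) ≠ (x + Pi.single 1 1, 0) := by
      intro h; have := congrArg (fun f : HexVertex => f.1 0) h; simp at this
    have n12 : ((x + Pi.single 1 1, 0) : HexVertex) ≠ (x, 0) := by
      intro h; have := congrArg (fun f : HexVertex => f.1 1) h; simp at this
    have n02 : ((x + Pi.single 0 1, 0) : HexVertex) ≠ (x, 0) := by
      intro h; have := congrArg (fun f : HexVertex => f.1 0) h; simp at this
    exact hL1 (x, 1) hx _ _ _ h0 h1 h2 n01 n12 n02
  obtain ⟨H, hH0, hH1⟩ := exists_potential hΛ hanti hcl0 hcl1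
  refine ⟨H, ?_⟩
  intro v hv w hvw s t hs ht hs' ht' hst hor
  obtain ⟨x, hx⟩ := oriented_edge_cases hvw hs ht hs' ht' hst hor
  rcases hx with ⟨rfl, hx⟩ | ⟨rfl, hx⟩ <;>
    rcases hx with ⟨rfl, hs1, ht1⟩ | ⟨rfl, hs1, ht1⟩ | ⟨rfl, hs1, ht1⟩ <;> rw [hs1, ht1]
  · exact (hH0 x hv).1
  · exact (hH0 x hv).2.1
  · exact (hH0 x hv).2.2
  · exact (hH1 x hv).1
  · exact (hH1 x hv).2.1
  · exact (hH1 x hv).2.2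

end Summit.CriticalPhenomena.SAWScalingLimit.Theorems

end
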